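import Literature.NumberTheory.PAdicHodge.DualExpElliptic
import Literature.NumberTheory.EllipticCurves.PadicLogFiniteExtensionEquivProofs
import Literature.NumberTheory.EllipticCurves.FormalGroupChartLimitLogSurjectiveProofs
import Literature.NumberTheory.EllipticCurves.Kramer1981.KernelReductionTwoDivisible
import Literature.NumberTheory.GaloisRepresentations.LabelledWeightsDeRhamRank
import HarnessLib

/-!
# Non-degeneracy of `(b, P) ↦ Tr_{F/ℚ_p}(b · log_ω P)` on `F × E(F)`: the logarithm of `E(F)` spans `F` over `ℚ_p` (proofs only)

Topic `Literature/NumberTheory/PAdicHodge`; namespace `Literature.NumberTheory.PAdicHodge`. THEOREMS ONLY (no definition, no named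
fact, no instance, no `sorry`). Brick (K4-[N]) of the hT₂ programme of crux K★ `stmt-BirchSwinnertonDyer-22226`
(`Summits/…/Cruxes/StarredOptimalManinUnitFiveSeven/Lines/kato-lever-hT2-programme.md` §2 [N], §4 K4): the final algebraic step
of the surjectivity half of (S5b) `exists_smul_range_expStarCoord_iff_trace_log` — in EXACTLY its currency (`w : Valuation F ℝ≥0`
compatible with the valuative structure, `log_ω = FormalGroupChart.padicLogPointFiniteExt w V p`, the `ℚ_p`-trace of an arbitrary
`ℚ_p`-algebra structure on `F`, which is the canonical one):

* **`exists_forall_val_le_exists_padicLog_eq`** — the logarithm of `E(F)` contains a BALL: there is `ρ > 0` such that every `y ∈ F`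
  with `w y ≤ ρ` is `log_ω P` for some `P ∈ E(F)` (Silverman IV.6.4 (b): `log : U_ρ ⥲ B_ρ` for `ρ = |p|²`; tree
  `FormalGroupChart.image_limitLog_kernelLevel_eq` with its analytic inputs — completeness and Hensel lifts — discharged for an abstract
  local field by `Kramer1981.exists_limit_of_geometric` / `Kramer1981.exists_mem_kernel_zCoord_eq`, and the invariance of `log_ω` under
  equivalent valuations `padicLogPointFiniteExt_eq_of_isEquiv`);
* **`forall_trace_mul_eq_zero_of_forall_trace_mul_padicLog_eq_zero`** — `Tr(b · log_ω P) = 0` for all `P` ⟹ `Tr(b · x) = 0` for all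
  `x ∈ F` (a ball spans `F` over `ℚ_p`);
* **`eq_zero_of_forall_trace_mul_padicLog_eq_zero`** — [N]: `Tr(b · log_ω P) = 0` for all `P ∈ E(F)` ⟹ `b = 0` (non-degeneracy of the
  trace form of the finite separable extension `F/ℚ_p`, Mathlib `traceForm_nondegenerate`); and its twin
  `eq_zero_of_forall_trace_mul_padicLog_baseChange_eq_zero` for `W ×_{K₀} F` (the literal shape of (S5b)).

BSD / K★ are not proved by any of this; (S5b) itself (Tate duality + Kato's reciprocity law) stays cite-only.

## References
* [SilvermanAEC2009] J. H. Silverman, *AEC* (2009), Thm. IV.6.4 (b), Prop. VII.2.2, Prop. VII.6.3.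
* [Kato1993LNM1553] K. Kato, LNM 1553 (1993), Ch. II Thm. 1.4.1 (the trace pairing `D_dR(V) × D_dR(V*(1)) → K → ℚ_p`).
* [NeukirchANT1999] J. Neukirch, *ANT* (1999), Ch. II (5.2) (`F/ℚ_p` finite), Ch. I (2.8) (non-degenerate trace form).
-/

noncomputable section

open scoped Classical NNReal
open Field ValuativeRel
open Literature.NumberTheory.GaloisRepresentations
open Literature.NumberTheory.GaloisRepresentations.IsNonarchimedeanLocalField
open Literature.NumberTheory.EllipticCurves Literature.NumberTheory.EllipticCurves.FormalGroupChart WeierstrassCurve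

namespace Literature.NumberTheory.PAdicHodge

variable {F : Type} [Field F] [ValuativeRel F] [TopologicalSpace F] [IsNonarchimedeanLocalField F] [CharZero F]
  {p : ℕ} [Fact p.Prime]

/-- **The logarithm of `E(F)` contains a ball of `F`** (Silverman IV.6.4 (b) / VII.6.3): for an elliptic Weierstrass equation `V`
over the `p`-adic field `F`, integral for a valuation `w` compatible with the valuative structure, there is `ρ > 0` such that every
`y` with `w y ≤ ρ` is `log_ω P` for some `P ∈ E(F)` (indeed `P` in the level `U_{|p|²}`). [cite: SilvermanAEC2009, Thm. IV.6.4 (b) with Prop. VII.2.2] -/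
theorem exists_forall_val_le_exists_padicLog_eq (hp : valuation F p < 1) (V : WeierstrassCurve F) [V.IsElliptic]
    (w : Valuation F ℝ≥0) [w.Compatible] [V.IsIntegral w.integer] :
    ∃ ρ : ℝ≥0, 0 < ρ ∧ ∀ y : F, w y ≤ ρ → ∃ P : V.toAffine.Point, padicLogPointFiniteExt w V p P = y := by
  -- the real absolute value `w₀` and its equivalence with `w`
  obtain ⟨w₀, hw₀⟩ := Kramer1981.exists_valuation_eq_algNorm F
  have h01 : ∀ x : F, w₀ x ≤ 1 ↔ x ∈ 𝒪[F] := fun x => by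
    rw [← NNReal.coe_le_coe, hw₀, NNReal.coe_one]; exact algNorm_algebraMap_le_one_iff
  have hwv : w.IsEquiv (valuation F) := ValuativeRel.isEquiv w (valuation F)
  have heq : w.IsEquiv w₀ := by
    rw [Valuation.isEquiv_iff_val_le_one]
    intro x
    rw [h01, hwv.le_one_iff_le_one]
    exact Valuation.mem_integer_iff _ _ |>.symm
  -- an integral model over `𝒪[F]` (coefficientwise: `w₀ aᵢ ≤ 1 ↔ aᵢ ∈ 𝒪[F]`)
  haveI hV₀ : V.IsIntegral w₀.integer := isIntegral_of_isEquiv heq V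
  obtain ⟨W₀, hW₀⟩ : ∃ W₀ : WeierstrassCurve 𝒪[F], W₀.baseChange F = V :=
    ⟨⟨⟨V.a₁, (h01 _).1 (val_a₁_le_one (w := w₀) (V := V))⟩, ⟨V.a₂, (h01 _).1 (val_a₂_le_one (w := w₀) (V := V))⟩,
      ⟨V.a₃, (h01 _).1 (val_a₃_le_one (w := w₀) (V := V))⟩, ⟨V.a₄, (h01 _).1 (val_a₄_le_one (w := w₀) (V := V))⟩,
      ⟨V.a₆, (h01 _).1 (val_a₆_le_one (w := w₀) (V := V))⟩⟩, rfl⟩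
  subst hW₀
  -- the analytic inputs for `w₀`
  have hp0 : (p : F) ≠ 0 := Nat.cast_ne_zero.mpr (Fact.out : p.Prime).ne_zero
  have hp0' : 0 < w₀ (p : F) := (Valuation.pos_iff _).mpr hp0
  have hp1 : w₀ (p : F) < 1 := by
    rw [← NNReal.coe_lt_coe, hw₀, NNReal.coe_one]; exact algNorm_algebraMap_lt_one_iff.mpr hp
  set ρ : ℝ≥0 := w₀ (p : F) ^ 2 with hρ
  have hρp : ρ < w₀ (p : F) := by rw [hρ, pow_two]; exact mul_lt_of_lt_one_left hp0' hp1
  have hρ1 : ρ < 1 := hρp.trans hp1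
  have hcomplete := Kramer1981.exists_limit_of_geometric hw₀
  have hlift : ∀ a : F, w₀ a ≤ ρ → ∃ P ∈ kernel w₀ (W₀.baseChange F), P.zCoord = a :=
    fun a ha ↦ Kramer1981.exists_mem_kernel_zCoord_eq hw₀ W₀ (ha.trans_lt hρ1)
  have hcomplete' : ∀ x : ℕ → F, (∀ r, w₀ (x (r + 1) - x r) ≤ w₀ (p : F) ^ (r + 1)) →
      ∃ y : F, ∀ r, w₀ (y - x r) ≤ w₀ (p : F) ^ (r + 1) := fun x hx => by
    obtain ⟨y, hy⟩ := hcomplete x (w₀ (p : F)) (w₀ (p : F)) hp1 (fun k ↦ by rw [← pow_succ']; exact hx k)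
    exact ⟨y, fun r ↦ by rw [pow_succ']; exact hy r⟩
  have hℓ := limitLog_spec (V := W₀.baseChange F) hp0 hcomplete'
  have himage := image_limitLog_kernelLevel_eq (V := W₀.baseChange F) hp0 hp1 hℓ le_rfl hlift hcomplete
  have hwp0 : 0 < w ((p : F) ^ 2) := (Valuation.pos_iff _).mpr (pow_ne_zero 2 hp0)
  refine ⟨w ((p : F) ^ 2), hwp0, fun y hy => ?_⟩
  have hy₀ : w₀ y ≤ ρ := by rw [hρ, ← map_pow]; exact (heq y ((p : F) ^ 2)).1 hy
  have hy' : y ∈ limitLog w₀ (W₀.baseChange F) p '' (kernelLevel w₀ (W₀.baseChange F) ρ : Set _) := by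
    rw [himage]; exact hy₀
  obtain ⟨Q, hQ, hQy⟩ := hy'
  refine ⟨Q, ?_⟩
  have hQlev : Q ∈ level w₀ (W₀.baseChange F) (w₀ (p : F)) := ⟨hQ.1, hQ.2.trans hρp.le⟩
  rw [padicLogPointFiniteExt_apply_eq_of_isEquiv heq, padicLogPointFiniteExt_eq_limitLog hp0 hp1 hℓ hQlev]
  exact hQy

/-- **`Tr(b · log_ω P) = 0` for every `P ∈ E(F)` forces `Tr(b · x) = 0` for every `x ∈ F`**: the logarithm of `E(F)` contains a ball,
and a ball spans `F` over `ℚ_p` (`x = p^{-N}·(p^N x)`). [cite: SilvermanAEC2009, Thm. IV.6.4 (b)] [cite: Kato1993LNM1553, Ch. II Thm. 1.4.1] -/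
theorem forall_trace_mul_eq_zero_of_forall_trace_mul_padicLog_eq_zero (hp : valuation F p < 1) [Algebra ℚ_[p] F]
    (V : WeierstrassCurve F) [V.IsElliptic] (w : Valuation F ℝ≥0) [w.Compatible] [V.IsIntegral w.integer] {b : F}
    (hb : ∀ P : V.toAffine.Point, Algebra.trace ℚ_[p] F (b * padicLogPointFiniteExt w V p P) = 0) (x : F) :
    Algebra.trace ℚ_[p] F (b * x) = 0 := by
  obtain ⟨ρ, hρ, hball⟩ := exists_forall_val_le_exists_padicLog_eq hp V w
  -- `w (p^N x) ≤ ρ` for large `N`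
  have hwp : w (p : F) < 1 := by
    have hwv : w.IsEquiv (valuation F) := ValuativeRel.isEquiv w (valuation F)
    exact hwv.lt_one_iff_lt_one.mpr hp
  obtain ⟨N, hN⟩ : ∃ N : ℕ, w (p : F) ^ N * w x ≤ ρ := by
    by_cases hx : w x = 0
    · exact ⟨0, by rw [hx, mul_zero]; exact zero_le⟩
    · obtain ⟨N, hN⟩ := NNReal.exists_pow_lt_of_lt_one (div_pos hρ (pos_iff_ne_zero.2 hx)) hwp
      exact ⟨N, ((lt_div_iff₀ (pos_iff_ne_zero.2 hx)).1 hN).le⟩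
  obtain ⟨P, hP⟩ := hball ((p : F) ^ N * x) (by rw [map_mul, map_pow]; exact hN)
  have h := hb P
  rw [hP] at h
  -- `Tr(b · p^N x) = p^N · Tr(b x)`
  have halg : ((p : ℚ_[p]) ^ N : ℚ_[p]) • (b * x) = b * ((p : F) ^ N * x) := by
    rw [Algebra.smul_def, map_pow, map_natCast]; ring
  rw [← halg, LinearMap.map_smul, smul_eq_zero] at h
  exact h.resolve_left (pow_ne_zero N (Nat.cast_ne_zero.mpr (Fact.out : p.Prime).ne_zero))

/-- **[N] Non-degeneracy: `Tr_{F/ℚ_p}(b · log_ω P) = 0` for every `P ∈ E(F)` forces `b = 0`.** For an elliptic Weierstrass equation `V`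
over the `p`-adic field `F` (ANY `ℚ_p`-algebra structure — it is the canonical one), integral for a compatible valuation `w`: the trace
form of the finite separable extension `F/ℚ_p` is non-degenerate (Mathlib `traceForm_nondegenerate`) and `log_ω(E(F))` spans `F` over
`ℚ_p`. The algebraic last step of the surjectivity half of (S5b). [cite: Kato1993LNM1553, Ch. II Thm. 1.4.1] [cite: NeukirchANT1999, Ch. I (2.8) and Ch. II (5.2)]
[cite: SilvermanAEC2009, Thm. IV.6.4 (b)] -/
theorem eq_zero_of_forall_trace_mul_padicLog_eq_zero (hp : valuation F p < 1) [Algebra ℚ_[p] F]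
    (V : WeierstrassCurve F) [V.IsElliptic] (w : Valuation F ℝ≥0) [w.Compatible] [V.IsIntegral w.integer] {b : F}
    (hb : ∀ P : V.toAffine.Point, Algebra.trace ℚ_[p] F (b * padicLogPointFiniteExt w V p P) = 0) : b = 0 := by
  -- the `ℚ_p`-algebra structure is the canonical one; `F/ℚ_p` is finite (and separable: characteristic `0`)
  have halg : (inferInstance : Algebra ℚ_[p] F) = LocalField.padicAlgebra F p hp := by
    refine Algebra.algebra_ext _ _ fun c => ?_
    exact RingHom.congr_fun (LocalField.ringHom_padic_ext (algebraMap ℚ_[p] F)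
      (@algebraMap ℚ_[p] F _ _ (LocalField.padicAlgebra F p hp))) c
  haveI : FiniteDimensional ℚ_[p] F := by
    have e := finiteDimensional_padicAlgebra (F := F) hp
    rw [← halg] at e
    exact e
  have hnd := traceForm_nondegenerate ℚ_[p] F
  refine hnd.1 b fun x => ?_
  rw [Algebra.traceForm_apply]
  exact forall_trace_mul_eq_zero_of_forall_trace_mul_padicLog_eq_zero hp V w hb x

/-- **[N] in the currency of (S5b)**: for an elliptic curve `W/K₀`, a `p`-adic field `F ⊇ K₀` with a compatible valuation `w` for
which `W ×_{K₀} F` is integral, `Tr_{F/ℚ_p}(b · log_ω P) = 0` for every `P ∈ (W ×_{K₀} F)(F)` forces `b = 0`.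
[cite: Kato1993LNM1553, Ch. II Thm. 1.4.1] [cite: SilvermanAEC2009, Thm. IV.6.4 (b)] -/
theorem eq_zero_of_forall_trace_mul_padicLog_baseChange_eq_zero {K₀ : Type} [Field K₀] (W : WeierstrassCurve K₀) [W.IsElliptic]
    [Algebra K₀ F] (hp : valuation F p < 1) [Algebra ℚ_[p] F]
    (w : Valuation F ℝ≥0) [w.Compatible] [(W.baseChange F).IsIntegral w.integer] {b : F}
    (hb : ∀ P : (W.baseChange F).toAffine.Point,
      Algebra.trace ℚ_[p] F (b * padicLogPointFiniteExt w (W.baseChange F) p P) = 0) : b = 0 :=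
  eq_zero_of_forall_trace_mul_padicLog_eq_zero hp (W.baseChange F) w hb

end Literature.NumberTheory.PAdicHodge

end
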